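import Summits.QuantumFields.BalabanUV.Beta.EriceRemainderEnclosureHistoryAutonomyFunctionalShiftLargeLimit
import Summits.QuantumFields.BalabanUV.Beta.EriceRemainderEnclosureHistoryAutonomyOrderOffset

/-!
# EriceRemainderEnclosureHistoryAutonomyFunctionalShiftLargeRate — (E52f) THE RATE OF THE Λ-SHIFT WITHOUT SMALLNESS: under the hypotheses of (E52c)
# `…FunctionalShiftLargeLimit` (`B` zeroth moment `M` OF ANY SIZE and floor `b`, `B′` floor `b` and sub-box excess `ρ`, ANY box solutions from two pins `p, p′ ≤ P`,
# a threshold scale `m₀`, `Σ_l ρ(c_{l+1}) < ∞`) the level shift approaches its limit `δ_∞` at the rate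
# `|D_{m₀+n} − δ_∞| ≤ 2·Σ_{i≥0} ρ(c_{m₀+n+i+1}) + 2M·D_max∕(b√b·√(m₀+n))` — the TAIL of the excess beyond the scale plus `m^{−1∕2}` from the memory (`D_max` the uniform
# bound of (E52c)); for ONE functional (`ρ ≡ 0`): the relative Λ-parameter of ANY two trajectories is approached like `2M·D_max∕(b√b·√m)` ((E44a)'s `T∕√n` for one
# pin, (E48g)'s `M·N·U∕(b√b·√n)` for ordered pins in a uniqueness regime — here any `M`, any pins, any solutions); and at the level of the COUPLINGS a uniform
# excess `η` is felt only like `η∕√m` while the pins are forgotten like `m^{−3∕2}`, for memory of any size ((E51b)'s merging without the sharp regime)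

Cell `pub-balaban`, β-function sub-cell, BINDER row D4 «RemainderConst leaves for Bałaban's split» (`HOME/BINDER-OWNERS.md`; owner lineage `b2b-balaban-beta-an4`;
this file by co-owner #2 lineage `b2b-balaban-beta-d4-p2`, generation 48), β-FLOW TEAM duty (1), FREEZE (0) honoured (def-free; Mathlib's
`dist_le_tsum_of_dist_le_of_tendsto₀`, node U2's `Sharpness.abs_sub_le_half_cube_mul`, (E48g)'s `sum_cube_tail_le`, (E51a)'s `envelope_pos` ∕ `envelope_le_pin` ∕
`envelope_anti` ∕ `profile_nonneg`, (E51b)'s `envelope_weights`, (E52a)'s `le_envelope_of_le_pin`, (E52b)'s `abs_disc_le_large_uniform`, (E52c)'s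
`abs_disc_le_large_of_summable` ∕ `abs_disc_succ_sub_le_post` ∕ `summable_shift_profile` ∕ `summable_shift_envelope_cube` BY NAME, nothing restated).  Sequel of (E52c),
split off for the 400-line rule.

HONEST FRAMING (page 1, verbatim and binding).  *"Discharging BetaPertH makes Bałaban's UV stability UNCONDITIONAL — a real constructive-QFT result; it is
NOT the continuum limit and NOT the Clay problem."*  THIS FILE DISCHARGES NOTHING OF THE KIND.  Elementary real analysis (the tail of a summable majorant bounds
the distance of a Cauchy sequence to its limit) about two ABSTRACT functionals on ]0,γ]^ℕ — hypotheses, not facts; nothing of Bałaban's (1.22) is asserted; the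
size of the zeroth moment of its limit functional is NOT PRINTED ([I] p. 298; GAPS G-t4-U2-1∕-2).  Row D4 class UNCHANGED (critical-path width 0; instance 0∕1;
D4 DISCHARGE NO DATE).  HONEST DEPENDENCY: continuum YM on T⁴ ⇐ BetaPertH ∧ nine spine estimates (0/9 proved); BetaPertH ⇐ (D1) ∧ (D4) ∧ CAP+tail; G-an2-4
gates asym, D1 and NE2/3/4.

WHAT IS PROVED ([folklore]; 0 `def`, 0 sorry).  §1 `sum_range_cube_shift_le` (`Σ_{i<k} c_{N+i+1}³ ≤ 2∕(b√b·√N)`), **`abs_disc_sub_lim_le_large`** (the rate).  §2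
**`abs_disc_sub_lim_le_large_init`** (one functional, two pins, any `M`: `|D_{m₀+n} − δ_∞| ≤ 2M·D_max∕(b√b·√(m₀+n))`).  §3 **`abs_sub_le_large_uniform`**
(uniform excess, any `M`, two pins: the COUPLINGS merge, `|h_m − h′_m| ≤ e^{6M∕(b√b)}·((|1∕p² − 1∕p′²| + 2M√m₀∕√b)∕(b√b·m√m) + η∕(b√b·√m))`).
-/

noncomputable section
open Filter Topology Finset

namespace Summit.QuantumFields.BalabanUV.Beta.EriceRemainderEnclosureHistoryAutonomyFunctionalShiftLargeRate

open Literature.MathematicalPhysics.QuantumFieldTheory.Balaban1983to89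
open Literature.MathematicalPhysics.QuantumFieldTheory.Balaban1983to89.T4BetaStationary
open Literature.MathematicalPhysics.QuantumFieldTheory.Balaban1983to89.T4BetaFlowWellPosed
open Literature.MathematicalPhysics.QuantumFieldTheory.Balaban1983to89.T4BetaFlowWellPosed.Sharpness (abs_sub_le_half_cube_mul)
open Summit.QuantumFields.BalabanUV.Beta.EriceRemainderEnclosureHistoryAutonomyFunctionalShift
  (envelope_pos envelope_le_pin envelope_anti profile_nonneg)
open Summit.QuantumFields.BalabanUV.Beta.EriceRemainderEnclosureHistoryAutonomyFunctionalShiftLimit (envelope_weights)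
open Summit.QuantumFields.BalabanUV.Beta.EriceRemainderEnclosureHistoryAutonomyOrderOffset (sum_cube_tail_le)
open Summit.QuantumFields.BalabanUV.Beta.EriceRemainderEnclosureHistoryAutonomyFunctionalShiftTwoPins (le_envelope_of_le_pin)
open Summit.QuantumFields.BalabanUV.Beta.EriceRemainderEnclosureHistoryAutonomyFunctionalShiftLarge (abs_disc_le_large_uniform)
open Summit.QuantumFields.BalabanUV.Beta.EriceRemainderEnclosureHistoryAutonomyFunctionalShiftLargeLimit

variable {B B' : (ℕ → ℝ) → ℝ} {M γ b p p' P : ℝ} {h h' : ℕ → ℝ} {ρ : ℝ → ℝ}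

/-! ## §1 The rate: the distance to the limit is the tail of the majorant -/

/-- The shifted cubed-envelope sums: `Σ_{i<k} c_{N+i+1}³ ≤ 2∕(b√b·√N)` for `N ≥ 1` ((E48g) `sum_cube_tail_le`). [folklore] -/
theorem sum_range_cube_shift_le (hb : 0 < b) (P : ℝ) {N : ℕ} (hN : 1 ≤ N) (k : ℕ) :
    ∑ i ∈ range k, (1 / Real.sqrt (1 / P ^ 2 + (((N + i : ℕ) : ℝ) + 1) * b)) ^ 3 ≤ 2 / (b * Real.sqrt b * Real.sqrt (N : ℝ)) := by
  have h1 := sum_cube_tail_le hb P hN (N + k)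
  rw [sum_Ico_eq_sum_range, Nat.add_sub_cancel_left] at h1
  have e : ∑ i ∈ range k, (1 / Real.sqrt (1 / P ^ 2 + (((N + i : ℕ) : ℝ) + 1) * b)) ^ 3
      = 2 * ∑ i ∈ range k, (1 / Real.sqrt (1 / P ^ 2 + (((N + i : ℕ) : ℝ) + 1) * b)) ^ 3 / 2 := by
    rw [mul_sum]; exact sum_congr rfl fun i _ => by ring
  rw [e]
  have hbb : 0 < b * Real.sqrt b * Real.sqrt (N : ℝ) := by
    have : (1 : ℝ) ≤ N := by exact_mod_cast hN
    positivity
  calc 2 * ∑ i ∈ range k, (1 / Real.sqrt (1 / P ^ 2 + (((N + i : ℕ) : ℝ) + 1) * b)) ^ 3 / 2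
      ≤ 2 * (1 / (b * Real.sqrt b * Real.sqrt (N : ℝ))) := mul_le_mul_of_nonneg_left h1 (by norm_num)
    _ = 2 / (b * Real.sqrt b * Real.sqrt (N : ℝ)) := by rw [mul_one_div]

/-- **THE RATE OF THE Λ-SHIFT, ANY `M`.**  With `D_max` the uniform bound of `abs_disc_le_large_of_summable` and `δ_∞` the limit: above the threshold,
`|D_{m₀+n} − δ_∞| ≤ 2·Σ_{i≥0} ρ(c_{m₀+n+i+1}) + 2M·D_max∕(b√b·√(m₀+n))` (`m₀ + n ≥ 1`) — the tail of the excess beyond the scale plus `m^{−1∕2}` from the memory.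
[folklore] -/
theorem abs_disc_sub_lim_le_large
    (hB : ∀ u u' : ℕ → ℝ, SeqBox γ u → SeqBox γ u' → ∀ D : ℝ, (∀ j, |u j - u' j| ≤ D) → |B u - B u'| ≤ M * D)
    (hM : 0 ≤ M) (hp : 0 < p) (hpP : p ≤ P) (hp' : 0 < p') (hp'P : p' ≤ P) (hPγ : P ≤ γ) (hb : 0 < b)
    (hlo : ∀ u, SeqBox γ u → b ≤ B u) (hlo' : ∀ u, SeqBox γ u → b ≤ B' u)
    (hρ : ∀ a : ℝ, 0 < a → a ≤ γ → ∀ u, SeqBox a u → |B u - B' u| ≤ ρ a)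
    (hsum : Summable fun l : ℕ => ρ (1 / Real.sqrt (1 / P ^ 2 + ((l : ℝ) + 1) * b)))
    (hh : SeqBox γ h) (hh' : SeqBox γ h') (hf : MemFlow B p h) (hf' : MemFlow B' p' h') {m₀ : ℕ}
    (hq : M * (1 / Real.sqrt (1 / P ^ 2 + (m₀ : ℝ) * b)) ≤ 3 * Real.sqrt 3 * b / 2)
    (hK : M * (1 / Real.sqrt (1 / P ^ 2 + (m₀ : ℝ) * b)) ^ 3 ≤ 1 / 2)
    {δ : ℝ} (hδ : Tendsto (fun m => 1 / h m ^ 2 - 1 / h' m ^ 2) atTop (𝓝 δ)) {n : ℕ} (hn : 1 ≤ m₀ + n) :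
    |(1 / h (m₀ + n) ^ 2 - 1 / h' (m₀ + n) ^ 2) - δ|
      ≤ 2 * ∑' i : ℕ, ρ (1 / Real.sqrt (1 / P ^ 2 + (((m₀ + n + i : ℕ) : ℝ) + 1) * b))
        + 2 * M * (2 * Real.exp (6 * M / (b * Real.sqrt b))
              * (|1 / p ^ 2 - 1 / p' ^ 2| + 2 * M * Real.sqrt (m₀ : ℝ) / Real.sqrt b
                  + ∑' l : ℕ, ρ (1 / Real.sqrt (1 / P ^ 2 + ((l : ℝ) + 1) * b))))
          / (b * Real.sqrt b * Real.sqrt ((m₀ + n : ℕ) : ℝ)) := by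
  have hP : 0 < P := hp.trans_le hpP
  have h33 : 0 < 3 * Real.sqrt 3 * b := by positivity
  set Dmax := 2 * Real.exp (6 * M / (b * Real.sqrt b))
    * (|1 / p ^ 2 - 1 / p' ^ 2| + 2 * M * Real.sqrt (m₀ : ℝ) / Real.sqrt b
        + ∑' l : ℕ, ρ (1 / Real.sqrt (1 / P ^ 2 + ((l : ℝ) + 1) * b))) with hDmax
  have hbound : ∀ m, |1 / h m ^ 2 - 1 / h' m ^ 2| ≤ Dmax := fun m =>
    abs_disc_le_large_of_summable hB hM hp hpP hp' hp'P hPγ hb hlo hlo' hρ hsum hh hh' hf hf' hq hK m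
  have hDmax0 : 0 ≤ Dmax := (abs_nonneg _).trans (hbound 0)
  -- restart the bookkeeping at the scale N = m₀ + n (itself a threshold scale)
  set N := m₀ + n with hN
  have hCN : 1 / Real.sqrt (1 / P ^ 2 + (N : ℝ) * b) ≤ 1 / Real.sqrt (1 / P ^ 2 + (m₀ : ℝ) * b) :=
    envelope_anti hb hP (Nat.le_add_right m₀ n)
  have hC0 : 0 ≤ 1 / Real.sqrt (1 / P ^ 2 + (N : ℝ) * b) := (envelope_pos hb hP N).le
  have hqN : M * (1 / Real.sqrt (1 / P ^ 2 + (N : ℝ) * b)) ≤ 3 * Real.sqrt 3 * b / 2 :=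
    (mul_le_mul_of_nonneg_left hCN hM).trans hq
  set c : ℕ → ℝ := fun i => 1 / Real.sqrt (1 / P ^ 2 + (((N + i : ℕ) : ℝ) + 1) * b) with hc
  have hc0 : ∀ i, 0 < c i := fun i => by simp only [hc]; positivity
  have hcγ : ∀ i, c i ≤ γ := fun i => by
    have := (envelope_le_pin hb hP (N + i + 1)).trans hPγ
    simp only [hc]
    push_cast at this ⊢
    exact this
  have hcN : ∀ i, M * c i ≤ 3 * Real.sqrt 3 * b / 2 := fun i => by
    have h1 : c i ≤ 1 / Real.sqrt (1 / P ^ 2 + (N : ℝ) * b) := by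
      have := envelope_anti hb hP (show N ≤ N + i + 1 by omega)
      simp only [hc]
      push_cast at this ⊢
      exact this
    exact (mul_le_mul_of_nonneg_left h1 hM).trans hqN
  have hρ0 : ∀ i, 0 ≤ ρ (c i) := fun i => profile_nonneg hρ (hc0 i) (hcγ i)
  set d : ℕ → ℝ := fun i => ρ (c i) + 2 * M * (c i ^ 3 / 2 * Dmax + c i / (3 * Real.sqrt 3 * b) * ρ (c i)) with hd
  have hinc : ∀ i, dist (1 / h (N + i) ^ 2 - 1 / h' (N + i) ^ 2) (1 / h (N + (i + 1)) ^ 2 - 1 / h' (N + (i + 1)) ^ 2)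
      ≤ d i := by
    intro i
    rw [Real.dist_eq, abs_sub_comm, ← Nat.add_assoc]
    have h1 := abs_disc_succ_sub_le_post hB hM hp hpP hp' hp'P hPγ hb hlo hlo' hρ hh hh' hf hf' hqN i
    have hY : c i ^ 3 / 2 * |1 / h (N + i + 1) ^ 2 - 1 / h' (N + i + 1) ^ 2| + c i / (3 * Real.sqrt 3 * b) * ρ (c i)
        ≤ c i ^ 3 / 2 * Dmax + c i / (3 * Real.sqrt 3 * b) * ρ (c i) :=
      add_le_add (mul_le_mul_of_nonneg_left (hbound (N + i + 1)) (by have := hc0 i; positivity)) le_rfl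
    have h2 := mul_le_mul_of_nonneg_left hY (by positivity : (0 : ℝ) ≤ 2 * M)
    simp only [hd]
    linarith
  have h1s : Summable fun i => ρ (c i) := summable_shift_profile hsum N
  have h2s : Summable fun i => c i ^ 3 := summable_shift_envelope_cube hb P N
  have hdsum : Summable d := by
    have h3 : Summable fun i => c i / (3 * Real.sqrt 3 * b) * ρ (c i) := by
      refine Summable.of_nonneg_of_le (fun i => by have := hc0 i; have := hρ0 i; positivity)
        (fun i => ?_) (h1s.mul_left (γ / (3 * Real.sqrt 3 * b)))
      exact mul_le_mul_of_nonneg_right (div_le_div_of_nonneg_right (hcγ i) h33.le) (hρ0 i)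
    refine (h1s.add (((h2s.mul_left (M * Dmax)).add (h3.mul_left (2 * M))))).congr fun i => ?_
    simp only [hd]; ring
  -- the shifted sequence converges to the same limit
  have hδN : Tendsto (fun i => 1 / h (N + i) ^ 2 - 1 / h' (N + i) ^ 2) atTop (𝓝 δ) := by
    have := (tendsto_add_atTop_iff_nat N).2 hδ
    refine this.congr fun i => ?_
    rw [Nat.add_comm]
  have hdist := dist_le_tsum_of_dist_le_of_tendsto₀ d hinc hdsum hδN
  rw [Real.dist_eq] at hdist
  simp only [Nat.add_zero] at hdist
  -- majorise the tail: d i ≤ 2 ρ(c i) + M·Dmax·c i³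
  have hdle : ∀ i, d i ≤ 2 * ρ (c i) + M * Dmax * c i ^ 3 := fun i => by
    have h1 : 2 * M * (c i / (3 * Real.sqrt 3 * b) * ρ (c i)) ≤ ρ (c i) := by
      have h2 : 2 * M * (c i / (3 * Real.sqrt 3 * b)) ≤ 1 := by
        rw [← mul_div_assoc, div_le_one h33]; linarith [hcN i]
      calc 2 * M * (c i / (3 * Real.sqrt 3 * b) * ρ (c i)) = (2 * M * (c i / (3 * Real.sqrt 3 * b))) * ρ (c i) := by ring
        _ ≤ 1 * ρ (c i) := mul_le_mul_of_nonneg_right h2 (hρ0 i)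
        _ = ρ (c i) := one_mul _
    simp only [hd]
    nlinarith
  have hmaj : Summable fun i => 2 * ρ (c i) + M * Dmax * c i ^ 3 := (h1s.mul_left 2).add (h2s.mul_left (M * Dmax))
  have htsum : ∑' i, d i ≤ ∑' i, (2 * ρ (c i) + M * Dmax * c i ^ 3) := hdsum.tsum_le_tsum hdle hmaj
  have hsplit : ∑' i, (2 * ρ (c i) + M * Dmax * c i ^ 3) = 2 * ∑' i, ρ (c i) + M * Dmax * ∑' i, c i ^ 3 := by
    rw [(h1s.mul_left 2).tsum_add (h2s.mul_left (M * Dmax)), tsum_mul_left, tsum_mul_left]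
  have hcube : ∑' i, c i ^ 3 ≤ 2 / (b * Real.sqrt b * Real.sqrt (N : ℝ)) :=
    h2s.tsum_le_of_sum_range_le fun k => sum_range_cube_shift_le hb P hn k
  have hMD : 0 ≤ M * Dmax := mul_nonneg hM hDmax0
  calc |(1 / h N ^ 2 - 1 / h' N ^ 2) - δ| ≤ ∑' i, d i := hdist
    _ ≤ 2 * ∑' i, ρ (c i) + M * Dmax * ∑' i, c i ^ 3 := by rw [← hsplit]; exact htsum
    _ ≤ 2 * ∑' i, ρ (c i) + M * Dmax * (2 / (b * Real.sqrt b * Real.sqrt (N : ℝ))) :=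
        add_le_add le_rfl (mul_le_mul_of_nonneg_left hcube hMD)
    _ = 2 * ∑' i, ρ (c i) + 2 * M * Dmax / (b * Real.sqrt b * Real.sqrt (N : ℝ)) := by ring

/-! ## §2 One functional: the rate of the relative Λ-parameter -/

/-- **THE RELATIVE Λ-PARAMETER IS APPROACHED LIKE `m^{−1∕2}` — ANY `M`, ANY TWO SOLUTIONS, TWO PINS.**  `B` with zeroth moment `M ≥ 0` of ANY size and floor `b > 0`
on ]0,γ]^ℕ; `h, h′` ANY box solutions of its flow with memory from pins `p, p′ ∈ ]0,γ]`; `m₀` a threshold scale for the envelope of `γ`; `δ_∞` the limit of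
`1∕h_m² − 1∕h′_m²` ((E52c) `exists_tendsto_disc_large_init`).  Then for `m₀ + n ≥ 1`:
`|(1∕h_{m₀+n}² − 1∕h′_{m₀+n}²) − δ_∞| ≤ 2M·D_max∕(b√b·√(m₀+n))`, `D_max = 2e^{6M∕(b√b)}·(|1∕p² − 1∕p′²| + 2M√m₀∕√b)`. [folklore] -/
theorem abs_disc_sub_lim_le_large_init
    (hB : ∀ u u' : ℕ → ℝ, SeqBox γ u → SeqBox γ u' → ∀ D : ℝ, (∀ j, |u j - u' j| ≤ D) → |B u - B u'| ≤ M * D)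
    (hM : 0 ≤ M) (hp : 0 < p) (hpγ : p ≤ γ) (hp' : 0 < p') (hp'γ : p' ≤ γ) (hb : 0 < b)
    (hlo : ∀ u, SeqBox γ u → b ≤ B u) (hh : SeqBox γ h) (hh' : SeqBox γ h') (hf : MemFlow B p h) (hf' : MemFlow B p' h')
    {m₀ : ℕ} (hq : M * (1 / Real.sqrt (1 / γ ^ 2 + (m₀ : ℝ) * b)) ≤ 3 * Real.sqrt 3 * b / 2)
    (hK : M * (1 / Real.sqrt (1 / γ ^ 2 + (m₀ : ℝ) * b)) ^ 3 ≤ 1 / 2)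
    {δ : ℝ} (hδ : Tendsto (fun m => 1 / h m ^ 2 - 1 / h' m ^ 2) atTop (𝓝 δ)) {n : ℕ} (hn : 1 ≤ m₀ + n) :
    |(1 / h (m₀ + n) ^ 2 - 1 / h' (m₀ + n) ^ 2) - δ|
      ≤ 2 * M * (2 * Real.exp (6 * M / (b * Real.sqrt b))
            * (|1 / p ^ 2 - 1 / p' ^ 2| + 2 * M * Real.sqrt (m₀ : ℝ) / Real.sqrt b))
        / (b * Real.sqrt b * Real.sqrt ((m₀ + n : ℕ) : ℝ)) := by
  have hρ : ∀ a : ℝ, 0 < a → a ≤ γ → ∀ u, SeqBox a u → |B u - B u| ≤ (fun _ : ℝ => (0 : ℝ)) a :=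
    fun a _ _ u _ => by simp
  have hsum : Summable fun l : ℕ => (fun _ : ℝ => (0 : ℝ)) (1 / Real.sqrt (1 / γ ^ 2 + ((l : ℝ) + 1) * b)) :=
    summable_zero
  have h1 := abs_disc_sub_lim_le_large (ρ := fun _ : ℝ => (0 : ℝ)) hB hM hp hpγ hp' hp'γ le_rfl hb hlo hlo hρ hsum
    hh hh' hf hf' hq hK hδ hn
  simpa only [tsum_zero, mul_zero, zero_add, add_zero] using h1

/-! ## §3 The couplings: for memory of any size they merge like `η∕√m + m^{−3∕2}` -/

/-- **THE COUPLINGS MERGE FOR MEMORY OF ANY SIZE.**  `B` (zeroth moment `M ≥ 0` of ANY size, floor `b > 0` on ]0,γ]^ℕ), `B′` (floor `b`, `|B − B′| ≤ η` on the box),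
ANY box solutions `h` of `(B, p)`, `h′` of `(B′, p′)` (`p, p′ ∈ ]0,γ]`), `m₀` a threshold scale for the envelope of `γ`.  Then for `m ≥ 1`
`|h_m − h′_m| ≤ e^{6M∕(b√b)}·((|1∕p² − 1∕p′²| + 2M√m₀∕√b)∕(b√b·m·√m) + η∕(b√b·√m))` — the levels separate like `m·η` ((E52b) `abs_disc_le_large_uniform`) but, read
through the half-cube sensitivity `c_m³∕2`, the COUPLINGS forget the pins like `m^{−3∕2}` and feel the excess only like `η∕√m` ((E51b) `abs_sub_le_of_uniform_excess`:
one pin, sharp regime). [folklore] -/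
theorem abs_sub_le_large_uniform {η : ℝ}
    (hB : ∀ u u' : ℕ → ℝ, SeqBox γ u → SeqBox γ u' → ∀ D : ℝ, (∀ j, |u j - u' j| ≤ D) → |B u - B u'| ≤ M * D)
    (hM : 0 ≤ M) (hp : 0 < p) (hpγ : p ≤ γ) (hp' : 0 < p') (hp'γ : p' ≤ γ) (hb : 0 < b)
    (hlo : ∀ u, SeqBox γ u → b ≤ B u) (hlo' : ∀ u, SeqBox γ u → b ≤ B' u) (hη : ∀ u, SeqBox γ u → |B u - B' u| ≤ η)
    (hh : SeqBox γ h) (hh' : SeqBox γ h') (hf : MemFlow B p h) (hf' : MemFlow B' p' h')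
    {m₀ : ℕ} (hq : M * (1 / Real.sqrt (1 / γ ^ 2 + (m₀ : ℝ) * b)) ≤ 3 * Real.sqrt 3 * b / 2)
    (hK : M * (1 / Real.sqrt (1 / γ ^ 2 + (m₀ : ℝ) * b)) ^ 3 ≤ 1 / 2) {m : ℕ} (hm : 1 ≤ m) :
    |h m - h' m|
      ≤ Real.exp (6 * M / (b * Real.sqrt b))
        * ((|1 / p ^ 2 - 1 / p' ^ 2| + 2 * M * Real.sqrt (m₀ : ℝ) / Real.sqrt b) / (b * Real.sqrt b * (m : ℝ) * Real.sqrt (m : ℝ))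
            + η / (b * Real.sqrt b * Real.sqrt (m : ℝ))) := by
  have hγ : 0 < γ := hp.trans_le hpγ
  have hη0 : 0 ≤ η := (abs_nonneg _).trans (hη _ (seqBox_const hγ))
  have hm0 : (0 : ℝ) < m := by exact_mod_cast hm
  set c := 1 / Real.sqrt (1 / γ ^ 2 + (m : ℝ) * b) with hc
  have hc0 : 0 < c := envelope_pos hb hγ m
  have hcm : h m ≤ c := le_envelope_of_le_pin hb hp hpγ hlo hh hf m
  have hcm' : h' m ≤ c := le_envelope_of_le_pin hb hp' hp'γ hlo' hh' hf' m
  set A := |1 / p ^ 2 - 1 / p' ^ 2| + 2 * M * Real.sqrt (m₀ : ℝ) / Real.sqrt b with hA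
  have hA0 : 0 ≤ A := by positivity
  set E := Real.exp (6 * M / (b * Real.sqrt b)) with hE
  have hE0 : 0 < E := Real.exp_pos _
  -- the levels, then the half-cube sensitivity
  have hD := abs_disc_le_large_uniform hB hM hp hpγ hp' hp'γ hb hlo hlo' hη hh hh' hf hf' hq hK m
  have h1 : |h m - h' m| ≤ c ^ 3 / 2 * |1 / h m ^ 2 - 1 / h' m ^ 2| := abs_sub_le_half_cube_mul (hh m).1 (hh' m).1 hcm hcm'
  obtain ⟨-, hw⟩ := envelope_weights hb hγ hm
  -- c³ ≤ (m·c³)/m ≤ 1/(b√b·√m·m)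
  have hc3 : c ^ 3 ≤ 1 / (b * Real.sqrt b * (m : ℝ) * Real.sqrt (m : ℝ)) := by
    rw [le_div_iff₀ (by positivity)]
    have := mul_le_mul_of_nonneg_left hw (by positivity : (0 : ℝ) ≤ b * Real.sqrt b * Real.sqrt (m : ℝ))
    rw [mul_one_div_cancel (by positivity : b * Real.sqrt b * Real.sqrt (m : ℝ) ≠ 0)] at this
    nlinarith [this]
  have hmc3 : (m : ℝ) * c ^ 3 ≤ 1 / (b * Real.sqrt b * Real.sqrt (m : ℝ)) := hw
  calc |h m - h' m| ≤ c ^ 3 / 2 * |1 / h m ^ 2 - 1 / h' m ^ 2| := h1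
    _ ≤ c ^ 3 / 2 * (2 * E * (A + (m : ℝ) * η)) := mul_le_mul_of_nonneg_left hD (by positivity)
    _ = E * (A * c ^ 3 + η * ((m : ℝ) * c ^ 3)) := by ring
    _ ≤ E * (A * (1 / (b * Real.sqrt b * (m : ℝ) * Real.sqrt (m : ℝ))) + η * (1 / (b * Real.sqrt b * Real.sqrt (m : ℝ)))) := by
        refine mul_le_mul_of_nonneg_left (add_le_add (mul_le_mul_of_nonneg_left hc3 hA0) (mul_le_mul_of_nonneg_left hmc3 hη0)) hE0.le
    _ = E * (A / (b * Real.sqrt b * (m : ℝ) * Real.sqrt (m : ℝ)) + η / (b * Real.sqrt b * Real.sqrt (m : ℝ))) := by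
        rw [mul_one_div, mul_one_div]

end Summit.QuantumFields.BalabanUV.Beta.EriceRemainderEnclosureHistoryAutonomyFunctionalShiftLargeRate

end
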